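import Summits.BirchSwinnertonDyer.BirchSwinnertonDyer.Theorems.GoldfeldAllTwistsTwoConverseTwinOddTwoPrimesTwistSelmer
import HarnessLib

set_option linter.dupNamespace false -- namespace `…BirchSwinnertonDyer.BirchSwinnertonDyer…` is the cell's (D-0017 nested layout)
set_option autoImplicit false

/-!
# Twin″ (item 19140), LINE B⁗ object X0, part a2: the dual Selmer set `S′ = S(42qp, −7q²p²)` of `49a1^{(−qp)}` has order `≤ 4`
# (cells C4 ∪ C8: `q ≡ 7 (mod 8)`)

Cell `bsd-goldfeld`, seat `bsd-goldfeld-s1p-c3x` (gen 11); planner ORDER (cccxvii) «LINE B⁗ — TRANCHE 3», object X0, second file (consumes part a1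
`…TwinOddTwoPrimesTwistSelmer`: the `7`-adic kill and the symbols). `--supports stmt-BirchSwinnertonDyer-19140` as a HELPER. FACT-FREE: no print
binder, no definition, no `sorry`. HONEST FRAMING: a Selmer-set count; nothing about `L`-values; BSD is not proved by any of this.

`S′ = S(42qp, −7q²p²)` (the sixteen squarefree divisors of `7qp`, both signs): the discriminant `(42qp)² + 28q²p² = 7·(16qp)²` is exactly divisible
by `7`, so `{−1, q, −p, qp}` (`(d/7) = −1`) and `{7, −7q, 7p, −7qp}` (`(d′/7) = −1`) die at `7`; `−q, 7q` die at `p` (`(−q/p) = (7q/p) = −1`, part VIII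
`not_isSoluble_padic_of_nonresidue_of_sq_dvd`). Hence `S′ ⊆ {1, −7, p, −7p, −qp, 7qp}` — and `#S′` is a power of two, so **`#S′ ≤ 4`** (no type split:
on α the survivors are `{1, −7, p, −7p}`, on β `{1, −7, −qp, 7qp}`; brute-force kill table on HOME/STATUS X0 line).
References: [SilvermanAEC2009] X.4.9–X.4.10; [Zywina2025] Lemma 3.1 (proof).
-/

noncomputable section

open scoped Classical

open Literature.NumberTheory.EllipticCurves
open Literature.NumberTheory.EllipticCurves.Zywina2025 (isSquare_zmod_of_isSoluble_padic)

namespace Summit.BirchSwinnertonDyer.BirchSwinnertonDyer.Theorems.GoldfeldGoodTwists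

section OddSelmerDual
variable {q p : ℕ} [Fact q.Prime] [Fact p.Prime]

/-- **`S′ = S(42qp, −7q²p²) ⊆ {1, −7, p, −7p, −qp, 7qp}`** (same hypotheses): the sixteen squarefree divisors of `7qp` lose
`{−1, q, −p, qp}` and `{7, −7q, 7p, −7qp}` at `7` and `{−q, 7q}` at `p`. [cite: SilvermanAEC2009, Prop. X.4.9] [cite: Zywina2025, Lemma 3.1 (proof)] -/
theorem mem_of_mem_twoIsogenySelmerGroup'_oddTwoPrimesTwist (hq8 : q % 8 = 7) (hq7 : jacobiSym q 7 = -1) (hp8 : p % 8 = 5)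
    (hp7 : legendreSym p (-7) = 1) (hpq : jacobiSym p q = -1) {d : ℤ}
    (hd : d ∈ twoIsogenySelmerGroup' (-21 * ((q : ℤ) * p)) (112 * ((q : ℤ) * p) ^ 2)) :
    d ∈ ({1, -7, (p : ℤ), -7 * (p : ℤ), -((q : ℤ) * p), 7 * ((q : ℤ) * p)} : Finset ℤ) := by
  have hq : q.Prime := Fact.out
  have hp : p.Prime := Fact.out
  haveI : Fact (Nat.Prime 7) := ⟨by norm_num⟩
  have hqZ : Prime (q : ℤ) := Nat.prime_iff_prime_int.mp hq
  have hpZ : Prime (p : ℤ) := Nat.prime_iff_prime_int.mp hp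
  have hq0 : (q : ℤ) ≠ 0 := by exact_mod_cast hq.ne_zero
  have hp0 : (p : ℤ) ≠ 0 := by exact_mod_cast hp.ne_zero
  obtain ⟨⟨hq2, hp2, hqp, h7qp, h7Q, h7P⟩, ⟨h7_q, h7_p, hq07, hp07⟩, ⟨h2p, h7p, hm1p, hqp_p⟩, -, ⟨hqp0, hpq0⟩⟩ :=
    oddTwoPrimes_facts hq8 hq7 hp8 hp7 hpq
  have hq7' : q ≠ 7 := by rintro rfl; rw [jacobiSym.mod_left] at hq7; norm_num at hq7
  have hp7' : p ≠ 7 := by rintro rfl; norm_num at hp8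
  -- the two non-residues mod `p`
  have hns_negq_p : ¬ IsSquare ((((q : ℤ) * -1 : ℤ)) : ZMod p) :=
    (legendreSym.eq_neg_one_iff p).mp (by rw [legendreSym.mul, hqp_p, hm1p]; norm_num)
  have hns_7q_p : ¬ IsSquare ((((q : ℤ) * 7 : ℤ)) : ZMod p) :=
    (legendreSym.eq_neg_one_iff p).mp (by rw [legendreSym.mul, hqp_p, h7p]; norm_num)
  have hns_7q_p' : ¬ IsSquare (((7 * q : ℤ)) : ZMod p) := by rw [show (7 * q : ℤ) = q * 7 by ring]; exact hns_7q_p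
  have hns_negq_p' : ¬ IsSquare (((-q : ℤ)) : ZMod p) := by rw [show (-q : ℤ) = q * -1 by ring]; exact hns_negq_p
  have hA : (-2 * (-21 * ((q : ℤ) * p))) = 42 * ((q : ℤ) * p) := by ring
  have hB : ((-21 * ((q : ℤ) * p)) ^ 2 - 4 * (112 * ((q : ℤ) * p) ^ 2)) = -7 * ((q : ℤ) * p) ^ 2 := by ring
  have hb : (-7 * ((q : ℤ) * p) ^ 2 : ℤ) ≠ 0 := mul_ne_zero (by norm_num) (pow_ne_zero 2 (mul_ne_zero hq0 hp0))
  rw [twoIsogenySelmerGroup'_eq, hA, hB, mem_twoIsogenySelmerGroup_iff hb] at hd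
  obtain ⟨hsqf, ⟨d', hdd'⟩, hloc⟩ := hd
  have hd'eq : (-7 * ((q : ℤ) * p) ^ 2 : ℤ) / d = d' := by rw [hdd', Int.mul_ediv_cancel_left _ hsqf.ne_zero]
  rw [hd'eq] at hloc
  obtain ⟨-, hpadic⟩ := hloc
  -- `d ∣ 7qp`
  have h0 : d ∣ -7 * ((q : ℤ) * p) ^ 2 := ⟨d', hdd'⟩
  have h1 : d ∣ (7 * ((q : ℤ) * p)) ^ 2 := h0.trans ⟨-7, by ring⟩
  have h7qp' : d ∣ 7 * ((q : ℤ) * p) := (hsqf.dvd_pow_iff_dvd (by norm_num)).mp h1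
  have hQP7 : ∀ n : ℤ, ¬ (7 : ℤ) ∣ n → ¬ (7 : ℤ) ∣ n * ((q : ℤ) * p) ^ 2 := fun n hn ↦
    not_seven_dvd_mul_oddTwoPrimes hn (by rw [sq]; exact not_seven_dvd_mul_oddTwoPrimes (not_seven_dvd_mul_oddTwoPrimes h7Q h7P) (not_seven_dvd_mul_oddTwoPrimes h7Q h7P))
  have hQP07 : ((((q : ℤ) * p : ℤ)) : ZMod 7) ≠ 0 := by push_cast at hq07 hp07 ⊢; exact mul_ne_zero hq07 hp07
  simp only [Finset.mem_insert, Finset.mem_singleton]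
  by_cases hqd : (q : ℤ) ∣ d
  · obtain ⟨e, rfl⟩ := hqd
    have he7p : e ∣ 7 * (p : ℤ) := by
      have : (q : ℤ) * e ∣ (q : ℤ) * (7 * p) := by rw [show (q : ℤ) * (7 * p) = 7 * (q * p) by ring]; exact h7qp'
      exact (mul_dvd_mul_iff_left hq0).mp this
    have hd'e : e * d' = -7 * (q : ℤ) * p ^ 2 := mul_left_cancel₀ hq0 (by linear_combination (-1 : ℤ) * hdd')
    by_cases hpe : (p : ℤ) ∣ e
    · -- `d = qp·e₂`, `e₂ ∣ 7`: `qp`, `−7qp` die at `7`; `−qp`, `7qp` survive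
      obtain ⟨e₂, rfl⟩ := hpe
      have he7 : e₂ ∣ 7 := by
        have : (p : ℤ) * e₂ ∣ (p : ℤ) * 7 := by rw [mul_comm (p : ℤ) 7]; exact he7p
        exact (mul_dvd_mul_iff_left hp0).mp this
      have hd'e₂ : e₂ * d' = -7 * (q : ℤ) * p := mul_left_cancel₀ hp0 (by linear_combination hd'e)
      have hle : e₂ ≤ 7 := Int.le_of_dvd (by norm_num) he7
      have hge : -7 ≤ e₂ := by have := Int.le_of_dvd (by norm_num) ((Int.neg_dvd).mpr he7); linarith
      have hne1 : e₂ ≠ 1 := by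
        rintro rfl
        refine not_isSoluble_seven_odd h7qp hdd'.symm
          (by rw [show (q : ℤ) * ((p : ℤ) * 1) = q * p by ring]; exact not_seven_dvd_mul_oddTwoPrimes h7Q h7P) ?_ (hpadic 7)
        rw [show (q : ℤ) * ((p : ℤ) * 1) = q * p by ring, legendreSym.mul, h7_q, h7_p]; norm_num
      have hnem7 : e₂ ≠ -7 := by
        rintro rfl
        have hd'1 : d' = (q : ℤ) * p := mul_left_cancel₀ (by norm_num : (-7 : ℤ) ≠ 0) (by linear_combination hd'e₂)
        refine not_isSoluble_seven_odd' h7qp hdd'.symm (by rw [hd'1]; exact not_seven_dvd_mul_oddTwoPrimes h7Q h7P) ?_ (hpadic 7)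
        rw [hd'1, legendreSym.mul, h7_q, h7_p]; norm_num
      obtain ⟨k, hk⟩ := he7
      have hcases : e₂ = -1 ∨ e₂ = 7 := by interval_cases e₂ <;> omega
      rcases hcases with rfl | rfl
      · right; right; right; right; left; ring
      · right; right; right; right; right; ring
    · -- `d = q·e`, `e ∣ 7`: `q`, `−7q` die at `7`; `−q`, `7q` at `p`
      exfalso
      have hcop : IsCoprime e (p : ℤ) := ((hpZ.irreducible.coprime_iff_not_dvd).mpr hpe).symm
      have he7 : e ∣ 7 := hcop.dvd_of_dvd_mul_right he7p
      have hle : e ≤ 7 := Int.le_of_dvd (by norm_num) he7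
      have hge : -7 ≤ e := by have := Int.le_of_dvd (by norm_num) ((Int.neg_dvd).mpr he7); linarith
      have hne1 : e ≠ 1 := by
        rintro rfl
        refine not_isSoluble_seven_odd h7qp hdd'.symm (by rw [mul_one]; exact h7Q) ?_ (hpadic 7)
        rw [mul_one, h7_q]
      have hnem7 : e ≠ -7 := by
        rintro rfl
        have hd'1 : d' = (q : ℤ) * p ^ 2 := mul_left_cancel₀ (by norm_num : (-7 : ℤ) ≠ 0) (by linear_combination hd'e)
        refine not_isSoluble_seven_odd' h7qp hdd'.symm ?_ ?_ (hpadic 7)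
        · rw [hd'1]; exact not_seven_dvd_mul_oddTwoPrimes h7Q (by rw [sq]; exact not_seven_dvd_mul_oddTwoPrimes h7P h7P)
        · rw [hd'1, legendreSym.mul, legendreSym.sq_one' 7 hp07, h7_q]; norm_num
      have hnem1 : e ≠ -1 := by
        rintro rfl
        exact not_isSoluble_padic_of_nonresidue_of_sq_dvd (p := p) (c := 42 * q) (e' := 7 * q) (by ring)
          (by linear_combination (-1 : ℤ) * hd'e) hns_negq_p hns_7q_p' (hpadic p)
      have hne7 : e ≠ 7 := by
        rintro rfl
        exact not_isSoluble_padic_of_nonresidue_of_sq_dvd (p := p) (c := 42 * q) (e' := -q) (by ring)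
          (mul_left_cancel₀ (by norm_num : (7 : ℤ) ≠ 0) (by linear_combination hd'e)) hns_7q_p hns_negq_p' (hpadic p)
      obtain ⟨k, hk⟩ := he7
      interval_cases e <;> omega
  · have hcop : IsCoprime d (q : ℤ) := ((hqZ.irreducible.coprime_iff_not_dvd).mpr hqd).symm
    have hd7p : d ∣ 7 * (p : ℤ) := hcop.dvd_of_dvd_mul_right (by rw [show 7 * (p : ℤ) * q = 7 * (q * p) by ring]; exact h7qp')
    by_cases hpd : (p : ℤ) ∣ d
    · -- `d = p·e`, `e ∣ 7`: `−p`, `7p` die at `7`; `p`, `−7p` survive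
      obtain ⟨e, rfl⟩ := hpd
      have he7 : e ∣ 7 := by
        have : (p : ℤ) * e ∣ (p : ℤ) * 7 := by rw [mul_comm (p : ℤ) 7]; exact hd7p
        exact (mul_dvd_mul_iff_left hp0).mp this
      have hd'e : e * d' = -7 * (q : ℤ) ^ 2 * p := mul_left_cancel₀ hp0 (by linear_combination (-1 : ℤ) * hdd')
      have hle : e ≤ 7 := Int.le_of_dvd (by norm_num) he7
      have hge : -7 ≤ e := by have := Int.le_of_dvd (by norm_num) ((Int.neg_dvd).mpr he7); linarith
      have hnem1 : e ≠ -1 := by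
        rintro rfl
        refine not_isSoluble_seven_odd h7qp hdd'.symm (by rw [mul_neg_one, Int.dvd_neg]; exact h7P) ?_ (hpadic 7)
        rw [legendreSym.mul, h7_p]; norm_num
      have hne7 : e ≠ 7 := by
        rintro rfl
        have hd'1 : d' = (q : ℤ) ^ 2 * (p * -1) := mul_left_cancel₀ (by norm_num : (7 : ℤ) ≠ 0) (by linear_combination hd'e)
        refine not_isSoluble_seven_odd' h7qp hdd'.symm ?_ ?_ (hpadic 7)
        · rw [hd'1]; exact not_seven_dvd_mul_oddTwoPrimes (by rw [sq]; exact not_seven_dvd_mul_oddTwoPrimes h7Q h7Q)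
            (by rw [mul_neg_one, Int.dvd_neg]; exact h7P)
        · rw [hd'1, legendreSym.mul, legendreSym.mul, legendreSym.sq_one' 7 hq07, h7_p]; norm_num
      obtain ⟨k, hk⟩ := he7
      have hcases : e = 1 ∨ e = -7 := by interval_cases e <;> omega
      rcases hcases with rfl | rfl
      · right; right; left; ring
      · right; right; right; left; ring
    · -- `d ∣ 7`: `−1`, `7` die at `7`; `1`, `−7` survive
      have hcopp : IsCoprime d (p : ℤ) := ((hpZ.irreducible.coprime_iff_not_dvd).mpr hpd).symm
      have hd7 : d ∣ 7 := hcopp.dvd_of_dvd_mul_right hd7p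
      have hle : d ≤ 7 := Int.le_of_dvd (by norm_num) hd7
      have hge : -7 ≤ d := by have := Int.le_of_dvd (by norm_num) ((Int.neg_dvd).mpr hd7); linarith
      have hnm1 : d ≠ -1 := by
        rintro rfl; exact not_isSoluble_seven_odd h7qp hdd'.symm (by decide) (by norm_num) (hpadic 7)
      have hn7 : d ≠ 7 := by
        rintro rfl
        have hd'1 : d' = -1 * ((q : ℤ) * p) ^ 2 := by linarith
        refine not_isSoluble_seven_odd' h7qp hdd'.symm (by rw [hd'1]; exact hQP7 (-1) (by decide)) ?_ (hpadic 7)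
        rw [hd'1, legendreSym.mul, legendreSym.sq_one' 7 hQP07]; norm_num
      obtain ⟨k, hk⟩ := hd7
      have hcases : d = 1 ∨ d = -7 := by interval_cases d <;> omega
      rcases hcases with rfl | rfl
      · left; rfl
      · right; left; rfl

/-- **`#S(42qp, −7q²p²) ≤ 4`**: a subset of six classes whose order is a power of two (Literature `exists_card_twoIsogenySelmerGroup'_eq_two_pow`).
[cite: SilvermanAEC2009, Prop. X.4.9] -/
theorem card_twoIsogenySelmerGroup'_oddTwoPrimesTwist_le (hq8 : q % 8 = 7) (hq7 : jacobiSym q 7 = -1) (hp8 : p % 8 = 5)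
    (hp7 : legendreSym p (-7) = 1) (hpq : jacobiSym p q = -1) :
    (twoIsogenySelmerGroup' (-21 * ((q : ℤ) * p)) (112 * ((q : ℤ) * p) ^ 2)).card ≤ 4 := by
  have hq : q.Prime := Fact.out
  have hp : p.Prime := Fact.out
  have hab := hab_inertTwist (m := q * p) (Nat.mul_pos hq.pos hp.pos)
  push_cast at hab
  obtain ⟨k, hk⟩ := exists_card_twoIsogenySelmerGroup'_eq_two_pow hab
  have h6 : (twoIsogenySelmerGroup' (-21 * ((q : ℤ) * p)) (112 * ((q : ℤ) * p) ^ 2)).card ≤ 6 :=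
    le_trans (Finset.card_le_card fun d hd ↦ mem_of_mem_twoIsogenySelmerGroup'_oddTwoPrimesTwist hq8 hq7 hp8 hp7 hpq hd)
      (Finset.card_le_six)
  rw [hk] at h6 ⊢
  have hk2 : k ≤ 2 := by
    by_contra hk3
    have : 2 ^ 3 ≤ 2 ^ k := Nat.pow_le_pow_right (by norm_num) (by omega)
    omega
  calc 2 ^ k ≤ 2 ^ 2 := Nat.pow_le_pow_right (by norm_num) hk2
    _ = 4 := by norm_num

end OddSelmerDual

end Summit.BirchSwinnertonDyer.BirchSwinnertonDyer.Theorems.GoldfeldGoodTwists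

end
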